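import Literature.NumberTheory.Sieve.CFSemigroupPrimitive
import HarnessLib

/-!
# Powers of the congruence transfer operator: the recursive word sums

Support file (all results proved) for the named fact
`Literature.NumberTheory.Sieve.MageeOhWinter2019_uniformCounting` (`CFSemigroupCounting.lean`).
First step of the Perron–Frobenius analysis of the congruence transfer operator `𝓜_{s,q}`
(`CFSemigroupTwisted.lean`, [MageeOhWinter2019, §3.2]): its powers are the twisted word sums
`(𝓜ⁿ F)_ξ(x) = Σ_{|w| = n} wt_{M_w}(x) F_{ξ σ_w}(M_w x)`, which we encode by the recursion
`T₀ F ξ x = F_ξ(x)`, `T_{n+1} F ξ x = Σ_{(a,b)} wt_{g_a g_b}(x) T_n F (ξ σ_{(a,b)}) (g_a g_b x)`: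

* `cfTwistSum` and `cfTwist_pow_apply` (`(𝓜ⁿ F)_ξ(x) = T_n F ξ x`);
* at `s = δ` on real non-negative fibres: `cfTwistSumR` (real recursion), non-negativity, the
  **path lower bound** `T_n F ξ x ≥ (Π weights along w) · F_{ξ σ_w}(M_w x)` for any twist-word `w`
  of length `n` (`cfTwistSumR_ge_path`), and the **uniform upper bound**
  `T_n F ξ x ≤ (max_η sup F_η) · (L_δ^{2n} 1)(x)` (`cfTwistSumR_le`) — the two sides of the Doeblin
  minorisation used with `cfTwist_primitive`. [cite: MageeOhWinter2019, §3.2]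

## References

* M. Magee, H. Oh, D. Winter, J. reine angew. Math. 753 (2019) 89–135, §3.2. [MageeOhWinter2019]
-/

noncomputable section

open Set
open scoped MatrixGroups

namespace Literature.NumberTheory.Sieve

variable {A : Finset ℕ}

/-! ### The recursive twisted word sums -/

section Sums

variable (A) (hA : ∀ a ∈ A, 1 ≤ a) (q : ℕ)
include hA

omit hA in
/-- The pair branch `g_a g_b · x` stays in `[0,1]`. [folklore] -/
theorem cfMoeb_pair_mem {a b : ℕ} (ha : 1 ≤ a) (hb : 1 ≤ b) {x : ℝ} (hx : x ∈ Icc (0 : ℝ) 1) :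
    cfMoeb (cfGen a * cfGen b) x ∈ Icc (0 : ℝ) 1 := by
  have h := cfMoeb_cfMat_mem (w := ![a, b]) (by intro i; fin_cases i <;> assumption) hx
  have hmat : cfMat ![a, b] = cfGen a * cfGen b := by
    rw [show (![a, b] : Fin 2 → ℕ) = Fin.append ![a] ![b] by
      funext i; fin_cases i <;> rfl, cfMat_append, cfMat_fin_one, cfMat_fin_one]
    rfl
  rwa [hmat] at h

/-- **The twisted word sums, recursively:** `T₀ F ξ x = F_ξ(x)`,
`T_{n+1} F ξ x = Σ_{(a,b)} wt_{g_a g_b}(x) · T_n F (ξ σ_{(a,b)}) (g_a g_b x)`. [cite: MageeOhWinter2019, §3.2] -/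
def cfTwistSum (s : ℂ) : ℕ → (SL(2, ZMod q) → CfLip) → SL(2, ZMod q) → ℝ → ℂ
  | 0, F, ξ, x => (F ξ).extend x
  | n + 1, F, ξ, x => ∑ a ∈ A.attach, ∑ b ∈ A.attach,
      cfWt s (cfGen (a : ℕ) * cfGen (b : ℕ)) x * cfTwistSum s n F (ξ * cfSigma q (a : ℕ) (b : ℕ)) (cfMoeb (cfGen (a : ℕ) * cfGen (b : ℕ)) x)

/-- **Powers of the congruence operator are the twisted word sums:** `(𝓜ⁿ F)_ξ(x) = T_n F ξ x` on `[0,1]`.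
[cite: MageeOhWinter2019, §3.2] -/
theorem cfTwist_pow_apply (s : ℂ) :
    ∀ (n : ℕ) (F : SL(2, ZMod q) → CfLip) (ξ : SL(2, ZMod q)) (x : Icc (0 : ℝ) 1),
      (cfTwist A hA q s ^ n) F ξ x = cfTwistSum A q s n F ξ x
  | 0, F, ξ, x => by simp [cfTwistSum, CfLip.extend_coe]
  | n + 1, F, ξ, x => by
      rw [pow_succ', ContinuousLinearMap.mul_def, ContinuousLinearMap.coe_comp, Function.comp_apply, cfTwist_apply,
        CfLip.finset_sum_apply, cfTwistSum]
      refine Finset.sum_congr rfl fun a _ => ?_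
      rw [CfLip.finset_sum_apply]
      refine Finset.sum_congr rfl fun b _ => ?_
      rw [cfPairOp_apply]
      congr 1
      have hy := cfMoeb_pair_mem (hA a a.2) (hA b b.2) x.2
      rw [CfLip.extend_of_mem _ hy]
      exact cfTwist_pow_apply s n F _ ⟨_, hy⟩

end Sums

/-! ### Real non-negative fibres at `s = δ`: the two sides of the Doeblin bound -/

section Real

variable (A) (hA : ∀ a ∈ A, 1 ≤ a) (q : ℕ)
include hA

/-- The real pair weight at `s = δ`: `((g_b x + a)(x + b))^{-2δ} = (denom²)^{-δ}`. [folklore] -/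
def cfWtR (a b : ℕ) (x : ℝ) : ℝ := ((cfDenom (cfGen a * cfGen b) x) ^ 2) ^ (-cfDimension A)

omit hA in
/-- The real weight is non-negative. [folklore] -/
theorem cfWtR_nonneg (a b : ℕ) (x : ℝ) : 0 ≤ cfWtR A a b x := Real.rpow_nonneg (sq_nonneg _) _

omit hA in
/-- The denominator of a pair at `x ∈ [0,1]`: `1 ≤ d ≤ (a+1)(b+1)`. [folklore] -/
theorem cfDenom_pair_bounds {a b : ℕ} (ha : 1 ≤ a) (hb : 1 ≤ b) {x : ℝ} (hx : x ∈ Icc (0 : ℝ) 1) :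
    1 ≤ cfDenom (cfGen a * cfGen b) x ∧ cfDenom (cfGen a * cfGen b) x ≤ ((a : ℝ) + 1) * ((b : ℝ) + 1) := by
  have ha1 : (1 : ℝ) ≤ a := by exact_mod_cast ha
  have hb1 : (1 : ℝ) ≤ b := by exact_mod_cast hb
  have hxb : 0 < cfDenom (cfGen b) x := by rw [cfDenom_cfGen]; linarith [hx.1]
  have hy : cfMoeb (cfGen b) x ∈ Icc (0 : ℝ) 1 := by rw [cfMoeb_cfGen]; exact one_div_add_mem_Icc hb hx
  rw [cfDenom_mul _ _ hxb.ne', cfDenom_cfGen, cfDenom_cfGen, cfMoeb_cfGen]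
  constructor
  · have h1 : 1 ≤ x + b := by linarith [hx.1]
    have h2 : 1 ≤ 1 / (x + b) + a := by
      have : 0 ≤ 1 / (x + b) := by positivity
      linarith
    nlinarith
  · have h1 : x + b ≤ (b : ℝ) + 1 := by linarith [hx.2]
    have h2 : 1 / (x + b) + a ≤ (a : ℝ) + 1 := by
      have := hy.2; rw [cfMoeb_cfGen] at this; linarith
    have h3 : 0 ≤ 1 / (x + b) + a := by have := hy.1; rw [cfMoeb_cfGen] at this; linarith
    nlinarith [hx.1]

/-- **Lower bound for the pair weight** on `[0,1]` when `a, b ≤ B`: `((B+1)^4)^{-δ} ≤ wt`. [folklore] -/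
theorem le_cfWtR (h2 : 2 ≤ A.card) {B : ℕ} (hB : ∀ a ∈ A, a ≤ B) {a b : ℕ} (ha : a ∈ A) (hb : b ∈ A) {x : ℝ}
    (hx : x ∈ Icc (0 : ℝ) 1) : ((((B : ℝ) + 1) ^ 4) ^ (-cfDimension A)) ≤ cfWtR A a b x := by
  have hδ := (cfDimension_pos hA h2).le
  obtain ⟨hd1, hdle⟩ := cfDenom_pair_bounds (hA a ha) (hA b hb) hx
  have haB : (a : ℝ) ≤ B := by exact_mod_cast hB a ha
  have hbB : (b : ℝ) ≤ B := by exact_mod_cast hB b hb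
  have hsq : cfDenom (cfGen a * cfGen b) x ^ 2 ≤ ((B : ℝ) + 1) ^ 4 := by
    have h1 : cfDenom (cfGen a * cfGen b) x ≤ ((B : ℝ) + 1) ^ 2 := by nlinarith
    nlinarith
  unfold cfWtR
  exact Real.rpow_le_rpow_of_nonpos (by positivity) hsq (by linarith)

/-- **The real twisted word sums** (the recursion of `cfTwistSum` with real weights at `s = δ`).
[cite: MageeOhWinter2019, §3.2] -/
def cfTwistSumR : ℕ → (SL(2, ZMod q) → ℝ → ℝ) → SL(2, ZMod q) → ℝ → ℝ
  | 0, Φ, ξ, x => Φ ξ x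
  | n + 1, Φ, ξ, x => ∑ a ∈ A.attach, ∑ b ∈ A.attach,
      cfWtR A (a : ℕ) (b : ℕ) x * cfTwistSumR n Φ (ξ * cfSigma q (a : ℕ) (b : ℕ)) (cfMoeb (cfGen (a : ℕ) * cfGen (b : ℕ)) x)

/-- **Real fibres:** if `F_ξ = Φ_ξ` (real) on `[0,1]` then `T_n F ξ x = T_n^ℝ Φ ξ x` on `[0,1]`.
[cite: MageeOhWinter2019, §3.2] -/
theorem cfTwistSum_ofReal {F : SL(2, ZMod q) → CfLip} {Φ : SL(2, ZMod q) → ℝ → ℝ}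
    (hF : ∀ ξ, ∀ y ∈ Icc (0 : ℝ) 1, (F ξ).extend y = (Φ ξ y : ℂ)) :
    ∀ (n : ℕ) (ξ : SL(2, ZMod q)) {x : ℝ}, x ∈ Icc (0 : ℝ) 1 →
      cfTwistSum A q (cfDimension A : ℂ) n F ξ x = (cfTwistSumR A q n Φ ξ x : ℂ)
  | 0, ξ, x, hx => by simp [cfTwistSum, cfTwistSumR, hF ξ x hx]
  | n + 1, ξ, x, hx => by
      simp only [cfTwistSum, cfTwistSumR, Complex.ofReal_sum, Complex.ofReal_mul]
      refine Finset.sum_congr rfl fun a _ => Finset.sum_congr rfl fun b _ => ?_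
      have hd := (cfDenom_pair_bounds (hA a a.2) (hA b b.2) hx).1
      rw [cfWt_ofReal _ _ (by linarith), cfTwistSum_ofReal hF n _ (cfMoeb_pair_mem (hA a a.2) (hA b b.2) hx)]
      rfl

/-- **Non-negativity** of the real twisted sums for non-negative fibres. [folklore] -/
theorem cfTwistSumR_nonneg {Φ : SL(2, ZMod q) → ℝ → ℝ} (hΦ : ∀ ξ, ∀ y ∈ Icc (0 : ℝ) 1, 0 ≤ Φ ξ y) :
    ∀ (n : ℕ) (ξ : SL(2, ZMod q)) {x : ℝ}, x ∈ Icc (0 : ℝ) 1 → 0 ≤ cfTwistSumR A q n Φ ξ x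
  | 0, ξ, x, hx => hΦ ξ x hx
  | n + 1, _, _, hx => Finset.sum_nonneg fun a _ => Finset.sum_nonneg fun b _ =>
      mul_nonneg (cfWtR_nonneg A _ _ _) (cfTwistSumR_nonneg hΦ n _ (cfMoeb_pair_mem (hA a a.2) (hA b b.2) hx))

/-- The end point `M_w x` of a twist-word path started at `x` (first pair applied first).
[folklore] -/
def cfPathPoint : List (A × A) → ℝ → ℝ
  | [], x => x
  | p :: w, x => cfPathPoint w (cfMoeb (cfGen ((p.1 : A) : ℕ) * cfGen ((p.2 : A) : ℕ)) x)

/-- The weight of a twist-word path: the product of the pair weights along it. [folklore] -/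
def cfPathWt : List (A × A) → ℝ → ℝ
  | [], _ => 1
  | p :: w, x => cfWtR A ((p.1 : A) : ℕ) ((p.2 : A) : ℕ) x * cfPathWt w (cfMoeb (cfGen ((p.1 : A) : ℕ) * cfGen ((p.2 : A) : ℕ)) x)

/-- Path points stay in `[0,1]`. [folklore] -/
theorem cfPathPoint_mem : ∀ (w : List (A × A)) {x : ℝ}, x ∈ Icc (0 : ℝ) 1 → cfPathPoint A w x ∈ Icc (0 : ℝ) 1
  | [], _, hx => hx
  | p :: w, _, hx => cfPathPoint_mem w (cfMoeb_pair_mem (hA _ p.1.2) (hA _ p.2.2) hx)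

/-- **Path weights are uniformly bounded below:** `((B+1)^4)^{-δ|w|} ≤ wt_w(x)` on `[0,1]`. [folklore] -/
theorem le_cfPathWt (h2 : 2 ≤ A.card) {B : ℕ} (hB : ∀ a ∈ A, a ≤ B) :
    ∀ (w : List (A × A)) {x : ℝ}, x ∈ Icc (0 : ℝ) 1 →
      ((((B : ℝ) + 1) ^ 4) ^ (-cfDimension A)) ^ w.length ≤ cfPathWt A w x
  | [], _, _ => by simp [cfPathWt]
  | p :: w, x, hx => by
      rw [List.length_cons, pow_succ', cfPathWt]
      exact mul_le_mul (le_cfWtR A hA h2 hB p.1.2 p.2.2 hx)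
        (le_cfPathWt h2 hB w (cfMoeb_pair_mem (hA _ p.1.2) (hA _ p.2.2) hx))
        (pow_nonneg (Real.rpow_nonneg (by positivity) _) _) (cfWtR_nonneg A _ _ _)

/-- **The path lower bound (Doeblin minorisation, lower side):** for non-negative fibres and every
twist-word `w`, `wt_w(x) · Φ_{ξ σ_w}(M_w x) ≤ T_{|w|}^ℝ Φ ξ x`. [cite: MageeOhWinter2019, §3.2] -/
theorem cfTwistSumR_ge_path {Φ : SL(2, ZMod q) → ℝ → ℝ} (hΦ : ∀ ξ, ∀ y ∈ Icc (0 : ℝ) 1, 0 ≤ Φ ξ y) :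
    ∀ (w : List (A × A)) (ξ : SL(2, ZMod q)) {x : ℝ}, x ∈ Icc (0 : ℝ) 1 →
      cfPathWt A w x * Φ (ξ * cfSigmaWord A q w) (cfPathPoint A w x) ≤ cfTwistSumR A q w.length Φ ξ x
  | [], ξ, x, hx => by simp [cfPathWt, cfPathPoint, cfTwistSumR]
  | p :: w, ξ, x, hx => by
      have hy := cfMoeb_pair_mem (hA _ p.1.2) (hA _ p.2.2) hx
      have ih := cfTwistSumR_ge_path hΦ w (ξ * cfSigma q ((p.1 : A) : ℕ) ((p.2 : A) : ℕ)) hy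
      have hσ : ξ * cfSigmaWord A q (p :: w) = ξ * cfSigma q ((p.1 : A) : ℕ) ((p.2 : A) : ℕ) * cfSigmaWord A q w := by
        rw [show p :: w = [p] ++ w from rfl, cfSigmaWord_append, cfSigmaWord_singleton, mul_assoc]
      have hterm := mul_le_mul_of_nonneg_left ih (cfWtR_nonneg A ((p.1 : A) : ℕ) ((p.2 : A) : ℕ) x)
      have hlhs : cfPathWt A (p :: w) x * Φ (ξ * cfSigmaWord A q (p :: w)) (cfPathPoint A (p :: w) x) =
          cfWtR A ((p.1 : A) : ℕ) ((p.2 : A) : ℕ) x *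
            (cfPathWt A w (cfMoeb (cfGen ((p.1 : A) : ℕ) * cfGen ((p.2 : A) : ℕ)) x) *
              Φ (ξ * cfSigma q ((p.1 : A) : ℕ) ((p.2 : A) : ℕ) * cfSigmaWord A q w)
                (cfPathPoint A w (cfMoeb (cfGen ((p.1 : A) : ℕ) * cfGen ((p.2 : A) : ℕ)) x))) := by
        rw [hσ, cfPathWt, cfPathPoint, mul_assoc]
      rw [hlhs, List.length_cons, cfTwistSumR]
      refine hterm.trans ?_
      -- a single non-negative term is at most the double sum
      have hnn : ∀ a ∈ A.attach, ∀ b ∈ A.attach, 0 ≤ cfWtR A (a : ℕ) (b : ℕ) x *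
          cfTwistSumR A q w.length Φ (ξ * cfSigma q (a : ℕ) (b : ℕ)) (cfMoeb (cfGen (a : ℕ) * cfGen (b : ℕ)) x) :=
        fun a _ b _ => mul_nonneg (cfWtR_nonneg A _ _ _)
          (cfTwistSumR_nonneg A hA q hΦ _ _ (cfMoeb_pair_mem (hA a a.2) (hA b b.2) hx))
      calc cfWtR A ((p.1 : A) : ℕ) ((p.2 : A) : ℕ) x *
            cfTwistSumR A q w.length Φ (ξ * cfSigma q ((p.1 : A) : ℕ) ((p.2 : A) : ℕ))
              (cfMoeb (cfGen ((p.1 : A) : ℕ) * cfGen ((p.2 : A) : ℕ)) x)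
          ≤ ∑ b ∈ A.attach, cfWtR A ((p.1 : A) : ℕ) (b : ℕ) x *
              cfTwistSumR A q w.length Φ (ξ * cfSigma q ((p.1 : A) : ℕ) (b : ℕ)) (cfMoeb (cfGen ((p.1 : A) : ℕ) * cfGen (b : ℕ)) x) :=
            Finset.single_le_sum (f := fun b : A => cfWtR A ((p.1 : A) : ℕ) (b : ℕ) x *
              cfTwistSumR A q w.length Φ (ξ * cfSigma q ((p.1 : A) : ℕ) (b : ℕ)) (cfMoeb (cfGen ((p.1 : A) : ℕ) * cfGen (b : ℕ)) x))
              (fun b hb => hnn p.1 (Finset.mem_attach _ _) b hb) (Finset.mem_attach _ p.2)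
        _ ≤ _ := Finset.single_le_sum (f := fun a : A => ∑ b ∈ A.attach, cfWtR A (a : ℕ) (b : ℕ) x *
              cfTwistSumR A q w.length Φ (ξ * cfSigma q (a : ℕ) (b : ℕ)) (cfMoeb (cfGen (a : ℕ) * cfGen (b : ℕ)) x))
              (fun a ha => Finset.sum_nonneg fun b hb => hnn a ha b hb) (Finset.mem_attach _ p.1)

/-- **The uniform upper bound (Doeblin, upper side):** if `0 ≤ Φ ≤ S` on `[0,1]` then
`T_n^ℝ Φ ξ x ≤ S · T_n^ℝ 𝟙 ξ x`. [folklore] -/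
theorem cfTwistSumR_le {Φ : SL(2, ZMod q) → ℝ → ℝ} {S : ℝ}
    (hΦS : ∀ ξ, ∀ y ∈ Icc (0 : ℝ) 1, Φ ξ y ≤ S) :
    ∀ (n : ℕ) (ξ : SL(2, ZMod q)) {x : ℝ}, x ∈ Icc (0 : ℝ) 1 →
      cfTwistSumR A q n Φ ξ x ≤ S * cfTwistSumR A q n (fun _ _ => 1) ξ x
  | 0, ξ, x, hx => by simpa [cfTwistSumR] using hΦS ξ x hx
  | n + 1, ξ, x, hx => by
      simp only [cfTwistSumR, Finset.mul_sum]
      refine Finset.sum_le_sum fun a _ => Finset.sum_le_sum fun b _ => ?_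
      rw [mul_left_comm]
      exact mul_le_mul_of_nonneg_left (cfTwistSumR_le hΦS n _ (cfMoeb_pair_mem (hA a a.2) (hA b b.2) hx))
        (cfWtR_nonneg A _ _ _)

/-- The constant family: `T_n^ℝ 𝟙 ξ x = (L_δ^{2n} 1)(x)` (two steps of the real transfer operator per pair).
[cite: MageeOhWinter2019, §3.2] -/
theorem cfTwistSumR_const_one :
    ∀ (n : ℕ) (ξ : SL(2, ZMod q)) (x : ℝ), x ∈ Icc (0 : ℝ) 1 →
      cfTwistSumR A q n (fun _ _ => 1) ξ x = (cfTransfer A (cfDimension A))^[2 * n] (fun _ => 1) x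
  | 0, _, _, _ => by simp [cfTwistSumR]
  | n + 1, ξ, x, hx => by
      rw [cfTwistSumR, show 2 * (n + 1) = (2 * n + 1) + 1 by ring, Function.iterate_succ_apply',
        Function.iterate_succ_apply', cfTransfer]
      -- `Σ_a Σ_b wt_{ab}(x) G(g_a g_b x) = Σ_b (x+b)^{-2δ} Σ_a (g_b x + a)^{-2δ} G(g_a (g_b x))`
      rw [Finset.sum_comm, ← Finset.sum_attach A]
      refine Finset.sum_congr rfl fun b _ => ?_
      rw [cfTransfer, Finset.mul_sum, ← Finset.sum_attach A]
      refine Finset.sum_congr rfl fun a _ => ?_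
      have hb1 : (1 : ℝ) ≤ (b : ℕ) := by exact_mod_cast hA b b.2
      have hxb : 0 < cfDenom (cfGen (b : ℕ)) x := by rw [cfDenom_cfGen]; linarith [hx.1]
      have hy : cfMoeb (cfGen (b : ℕ)) x ∈ Icc (0 : ℝ) 1 := by rw [cfMoeb_cfGen]; exact one_div_add_mem_Icc (hA b b.2) hx
      rw [cfTwistSumR_const_one n _ _ (cfMoeb_pair_mem (hA a a.2) (hA b b.2) hx), cfWtR,
        cfDenom_mul _ _ hxb.ne', cfMoeb_mul _ _ hxb.ne' (by
          rw [cfDenom_cfGen]; have ha1 : (1 : ℝ) ≤ ((a : ℕ) : ℝ) := by exact_mod_cast hA a a.2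
          linarith [hy.1]),
        cfDenom_cfGen, cfDenom_cfGen, cfMoeb_cfGen, cfMoeb_cfGen, mul_pow,
        Real.mul_rpow (sq_nonneg _) (sq_nonneg _)]
      ring

/-- **Uniform bound for the constant family:** `T_n^ℝ 𝟙 ξ x ≤ 4^δ`. [cite: MageeOhWinter2019, §3.2] -/
theorem cfTwistSumR_const_one_le (h2 : 2 ≤ A.card) (n : ℕ) (ξ : SL(2, ZMod q)) {x : ℝ} (hx : x ∈ Icc (0 : ℝ) 1) :
    cfTwistSumR A q n (fun _ _ => 1) ξ x ≤ (4 : ℝ) ^ cfDimension A := by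
  rw [cfTwistSumR_const_one A hA q n ξ x hx]
  have h := (cfTransfer_iterate_one_div_mem hA (nonempty_of_two_le_card h2) (cfDimension_pos hA h2).le (2 * n) hx).2
  rwa [cfEig, cfPressure_cfDimension hA h2, Real.exp_zero, one_pow, div_one] at h

end Real

end Literature.NumberTheory.Sieve
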